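import Summits.QuantumFields.BalabanUV.T4Continuum.Spine.NE2BalabanFinalRate
import Summits.QuantumFields.BalabanUV.T4Continuum.Spine.NE2BalabanStations

/-!
# T⁴ programme, spine node NE2 (U1a), tier B row B8 «general rate», PART 6 — THE RESOLVENT-ROUTE STATIONS AT A GENERAL GEOMETRIC RATE
# `ρ ∈ [L⁻¹, 1)` (named limit, rate, NE2-LIP, uniform convergence, HOLOMORPHY) and ROOT B's stations on row data at rate `θ`

NE2 formalisation swarm `b2b-balaban-t4-ne2-formalise-*`, leaf prover 08 (gen 2; rows B7 / B8 lineage — author of `Spine/NE2BalabanStations` (row B7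
file 8) and of PART 4 `Spine/NE2BalabanFinalRate`; INTENT CLAIMS.log 2026-08-20).  PART 1's stations `NE2ColourPerturbedLayer.{pertCovC_tendsto,
tendsto_pertLimC, pertLimC_sub_pertLimC_zero_le, consts_nonneg, tendstoUniformlyOn_pertCovC, differentiableOn_pertLimC, ne2Plus_resolvent_route_kron}`
hard-wire the majorant `C₂·L⁻¹^k` and `hL : 2 ≤ L`; at a general rate only the `TowerLimitRate` END existed (the owner's engine
`NE2ColourPerturbedLayerRate.towerLimitRate_perturbed_king_kron_rate`, p216739, and PART 4's END p219120).  THIS FILE re-types the stations: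
 * §1 GENERIC, for ANY `PerturbationLaws (Δ_a ⊗ 1) P (J ⊗ 1) κ (k ↦ C₂·ρ^k)`, `L⁻¹ ≤ ρ < 1`, `‖t‖κ < 1`: `tendsto_pertLimC_rate`
   (the NAMED limit `pertLimC P t` with `‖c_k(t) − c_∞(t)‖ ≤ Cpert(t)·ρ^k/(1 − ρ)`), `pertLimC_sub_pertLimC_zero_le_rate` (NE2-LIP
   `‖c_∞(t) − c_∞(0)‖ ≤ ‖t‖κ·Cst·(1 − ‖t‖κ)⁻¹` — PART 1's e₂-generic `pertLimC_sub_le_of_tendsto`), `consts_nonneg_rate`,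
   `tendstoUniformlyOn_pertCovC_rate` (uniform convergence on `{‖t‖ < τ}`, `τκ < 1`), `differentiableOn_pertLimC_rate` (HOLOMORPHY of
   `t ↦ c_∞(t)` on the Neumann disc — PART 1's e₂-generic
   `differentiableAt_pertCovC` + the locally uniform limit), and the bundle **`ne2Plus_resolvent_route_kron_rate`** (= `ne2Plus_resolvent_route_kron`
   with `L⁻¹ ↦ ρ`, `hL ↦ (hρ, hρ1)`);
 * §2 ON ROW DATA: **`balaban_final_stations_rate`** and **`balaban_final_stations_of_regular_rate (hd) (hreg) (hC) (hθ : L⁻¹ ≤ θ) (hθ1 : θ < 1)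
   (hNE3θ) (ha′) (hαη) (hβη) (hη : η ≤ etaStar …) (ht : ‖t‖ ≤ 1)`**, `differentiableOn_balaban_final_unitBall_rate` — twins of
   `NE2BalabanStations.{balaban_final_stations, balaban_final_stations_of_regular, differentiableOn_balaban_final_unitBall}` with the law
   `NE2BalabanFinalRate.perturbationLaws_balaban_final_rate` and the θ-FREE disc membership `NE2BalabanStations.norm_mul_kappaBs_lt_one_of_regular`;
   every letter unchanged; a kernel `example` re-derives the record's statement at `θ = L⁻¹` by `exact`.

HONEST FRAMING (T4-DAG p. 1).  Composition BY NAME at MODEL LEVEL (`Rg`, `a′` DATA; GLOBAL small field; no B0, c5); node NE3's `LocalRate … C θ`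
DISPLAYED (OPEN); ROOT B of record UNCHANGED and CONDITIONAL (c1/c2/c3/c7); finite torus, linear layer, operator norm; NOT [B9] (3.23)–(3.26) as printed;
**NE2 (U1a) NOT PROVED**; spine PROVED 0/9 unchanged; NOT infinite volume, NOT a mass gap, NOT Clay.  HONEST DEPENDENCY: continuum YM on T⁴ ⇐
BetaPertH ∧ nine spine estimates (0/9 proved); BetaPertH ⇐ (D1) ∧ (D4) ∧ CAP+tail; G-an2-4 gates asym, D1 and NE2/3/4.  ABSOLUTE RULE kept; no
`def … : Prop` fact; no new definition; no `sorry`.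
-/

noncomputable section

open scoped BigOperators ComplexConjugate Matrix Matrix.Norms.L2Operator Kronecker
open Filter Topology

namespace Summit.QuantumFields.BalabanUV.T4Continuum.NE2BalabanStationsRate

open Literature.MathematicalPhysics.QuantumFieldTheory.Balaban1983to89.B5Prop11Plancherel (Cst Cst_nonneg Tor fine)
open Literature.MathematicalPhysics.QuantumFieldTheory.Balaban1983to89.B5G183RateUnitTower (lev lev_neZero)
open Literature.MathematicalPhysics.QuantumFieldTheory.Balaban1983to89.T4EtaRateMin (LocalRate)
open Summit.QuantumFields.BalabanUV.T4Continuum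
open Summit.QuantumFields.BalabanUV.T4Continuum.CovariantAveragingTower (TowerLimitRate)
open Summit.QuantumFields.BalabanUV.T4Continuum.BalabanAveragedTowerUnit (idx Qlev)
open Summit.QuantumFields.BalabanUV.T4Continuum.BackgroundResolventTower
open Summit.QuantumFields.BalabanUV.T4Continuum.KingPairingPlantedLaw
open Summit.QuantumFields.BalabanUV.T4Continuum.GramPerturbationLaw (C2gram)
open Summit.QuantumFields.BalabanUV.T4Continuum.NE2FromNE3 (bgReadings)
open Summit.QuantumFields.BalabanUV.T4Continuum.NE2ColourPerturbedLayer (pertCovC pertLimC pertLimC_sub_le_of_tendsto differentiableAt_pertCovC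
  ne2Plus_resolvent_route_kron)
open Summit.QuantumFields.BalabanUV.T4Continuum.NE2ColourPerturbedLayerRate (towerLimitRate_perturbed_king_kron_rate)
open Summit.QuantumFields.BalabanUV.T4Continuum.PerturbedLimitAnalytic (Cpert_mono)
open Summit.QuantumFields.BalabanUV.T4Continuum.CovariantAveragingSummand (kappaQ kappaQ_ofReal)
open Summit.QuantumFields.BalabanUV.T4Continuum.RegularBackgroundTower (RegularTransporters regClass betaNE3)
open Summit.QuantumFields.BalabanUV.T4Continuum.GaugeTermPerturbationLaw (deltaK)
open Summit.QuantumFields.BalabanUV.T4Continuum.GaugeTermScalarData (QuT Q1)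
open Summit.QuantumFields.BalabanUV.T4Continuum.GaugeTermInstanceGeom (gS)
open Summit.QuantumFields.BalabanUV.T4Continuum.ScalarAveragedCompression (sigma0)
open Summit.QuantumFields.BalabanUV.T4Continuum.ScalarCovariantLaplacian (kappaS)
open Summit.QuantumFields.BalabanUV.T4Continuum.RegularSiteTransporters (siteT)
open Summit.QuantumFields.BalabanUV.T4Continuum.NestedContourTransport (theta0)
open Summit.QuantumFields.BalabanUV.T4Continuum.NE2BalabanRoot (balabanPert)
open Summit.QuantumFields.BalabanUV.T4Continuum.NE2BalabanGauge (gaugeSlot liftR)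
open Summit.QuantumFields.BalabanUV.T4Continuum.NE2BalabanLayerSharp (kappaBs C2Bs)
open Summit.QuantumFields.BalabanUV.T4Continuum.NE2BalabanWiring (epsR CdeltaR)
open Summit.QuantumFields.BalabanUV.T4Continuum.NE2BalabanFinal (tauR kappa4F C4F)
open Summit.QuantumFields.BalabanUV.T4Continuum.NE2BalabanThreshold (etaStar smallness_of_le)
open Summit.QuantumFields.BalabanUV.T4Continuum.NE2BalabanStations (norm_mul_kappaBs_lt_one_of_regular balaban_final_stations_of_regular)
open Summit.QuantumFields.BalabanUV.T4Continuum.NE2BalabanFinalRate (perturbationLaws_balaban_final_rate)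

variable {d : ℕ} (L : ℕ) [NeZero L] (M : Fin d → ℕ) [hM : ∀ μ, NeZero (M μ)] (a : ℝ) (ha : 0 < a)
variable {o : Type*} [Fintype o] [DecidableEq o]

/-! ## §1 The stations at a general rate `ρ ∈ [L⁻¹, 1)`, for any perturbation family -/

/-- **THE NAMED LIMIT WITH RATE `ρ^k`** (`L⁻¹ ≤ ρ < 1`, `‖t‖κ < 1`): the King-averaged colour covariances of `(Δ_a^{(k)} ⊗ 1 +
tP_k)⁻¹` CONVERGE to `pertLimC P t` with `‖c_k(t) − c_∞(t)‖ ≤ Cpert(t)·ρ^k/(1 − ρ)` — the owner's general-rate engine, the limit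
named by uniqueness (`tendsto_nhds_unique`). `NE2ColourPerturbedLayer.tendsto_pertLimC` is the case `ρ = L⁻¹`. [folklore] -/
theorem tendsto_pertLimC_rate {ρ : ℝ} (hρ : ((L : ℝ)⁻¹) ≤ ρ) (hρ1 : ρ < 1)
    {P : (k : ℕ) → Matrix (idx L M k × o) (idx L M k × o) ℂ} {κ C₂ : ℝ}
    (hpert : PerturbationLaws (fun k => calDalev L M a ha k ⊗ₖ (1 : Matrix o o ℂ)) P (fun k => JpcT L M k ⊗ₖ (1 : Matrix o o ℂ)) κ
      (fun k => C₂ * ρ ^ k)) {t : ℂ} (ht : ‖t‖ * κ < 1) :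
    Tendsto (pertCovC L M a ha P t) atTop (𝓝 (pertLimC L M a ha P t)) ∧
      ∀ k, ‖pertCovC L M a ha P t k - pertLimC L M a ha P t‖ ≤ Cpert κ (2 * d * Cst d a) (CJ d a) C₂ 0 t * ρ ^ k / (1 - ρ) := by
  obtain ⟨c, hc, hrate⟩ := towerLimitRate_perturbed_king_kron_rate L M a ha hρ hρ1 hpert ht
  have hc' : Tendsto (pertCovC L M a ha P t) atTop (𝓝 c) := hc
  have hlim : Tendsto (pertCovC L M a ha P t) atTop (𝓝 (pertLimC L M a ha P t)) := tendsto_nhds_limUnder ⟨c, hc'⟩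
  have heq : pertLimC L M a ha P t = c := tendsto_nhds_unique hlim hc'
  refine ⟨hlim, fun k => ?_⟩
  rw [heq]; exact hrate k

/-- **NE2-LIP FOR THE NAMED LIMIT AT RATE `ρ`**: `‖c_∞(t) − c_∞(0)‖ ≤ ‖t‖κ·Cst·(1 − ‖t‖κ)⁻¹` (PART 1's e₂-generic
`pertLimC_sub_le_of_tendsto` on the two limits of §1). [cite: Balaban1984PropagatorsI, Prop. 1.1 (1.89) p.33; Balaban1985BackgroundPropagators, Thm
3.4 p.400 (shape)] [folklore] -/
theorem pertLimC_sub_pertLimC_zero_le_rate {ρ : ℝ} (hρ : ((L : ℝ)⁻¹) ≤ ρ) (hρ1 : ρ < 1)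
    {P : (k : ℕ) → Matrix (idx L M k × o) (idx L M k × o) ℂ} {κ C₂ : ℝ}
    (hpert : PerturbationLaws (fun k => calDalev L M a ha k ⊗ₖ (1 : Matrix o o ℂ)) P (fun k => JpcT L M k ⊗ₖ (1 : Matrix o o ℂ)) κ
      (fun k => C₂ * ρ ^ k)) {t : ℂ} (ht : ‖t‖ * κ < 1) :
    ‖pertLimC L M a ha P t - pertLimC L M a ha P 0‖ ≤ ‖t‖ * κ * Cst d a * (1 - ‖t‖ * κ)⁻¹ := by
  have h0 : ‖(0 : ℂ)‖ * κ < 1 := by rw [norm_zero, zero_mul]; exact zero_lt_one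
  exact pertLimC_sub_le_of_tendsto L M a ha hpert ht (tendsto_pertLimC_rate L M a ha hρ hρ1 hpert ht).1
    (tendsto_pertLimC_rate L M a ha hρ hρ1 hpert h0).1

/-- the constants of a rate-`ρ` law are nonnegative (`e₂ 0 = C₂·ρ^0 = C₂`). [folklore] -/
theorem consts_nonneg_rate {ρ : ℝ} {P : (k : ℕ) → Matrix (idx L M k × o) (idx L M k × o) ℂ} {κ C₂ : ℝ}
    (hpert : PerturbationLaws (fun k => calDalev L M a ha k ⊗ₖ (1 : Matrix o o ℂ)) P (fun k => JpcT L M k ⊗ₖ (1 : Matrix o o ℂ)) κ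
      (fun k => C₂ * ρ ^ k)) :
    0 ≤ κ ∧ 0 ≤ C₂ := by
  refine ⟨(norm_nonneg _).trans (hpert.opNorm_P_mul_inv_le 0), ?_⟩
  have h := (norm_nonneg _).trans (hpert.consistent_le 0)
  simpa using h

/-- **UNIFORM CONVERGENCE ON SMALLER DISCS AT RATE `ρ`**: on `{‖t‖ < τ}` with `τκ < 1`, `c_k → c_∞` uniformly (bound `B·ρ^k`,
`B = Cpert(τ)/(1 − ρ)` by `Cpert_mono`). [folklore] -/
theorem tendstoUniformlyOn_pertCovC_rate {ρ : ℝ} (hρ : ((L : ℝ)⁻¹) ≤ ρ) (hρ1 : ρ < 1)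
    {P : (k : ℕ) → Matrix (idx L M k × o) (idx L M k × o) ℂ} {κ C₂ : ℝ}
    (hpert : PerturbationLaws (fun k => calDalev L M a ha k ⊗ₖ (1 : Matrix o o ℂ)) P (fun k => JpcT L M k ⊗ₖ (1 : Matrix o o ℂ)) κ
      (fun k => C₂ * ρ ^ k)) {τ : ℝ} (hτ : τ * κ < 1) :
    TendstoUniformlyOn (fun k t => pertCovC L M a ha P t k) (pertLimC L M a ha P) atTop {t : ℂ | ‖t‖ < τ} := by
  obtain ⟨hκ, hC₂⟩ := consts_nonneg_rate L M a ha hpert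
  have hρ0 : (0 : ℝ) ≤ ρ := (inv_nonneg.mpr (Nat.cast_nonneg L)).trans hρ
  set B : ℝ := ((CJ d a + τ * C₂) * ((1 - τ * κ)⁻¹) ^ 2 + (2 * d * Cst d a + 2 * 0) * (1 - τ * κ)⁻¹) / (1 - ρ) with hB
  have hbound : ∀ t : ℂ, ‖t‖ < τ → ∀ k, ‖pertCovC L M a ha P t k - pertLimC L M a ha P t‖ ≤ B * ρ ^ k := by
    intro t htτ k
    have ht : ‖t‖ * κ < 1 := lt_of_le_of_lt (mul_le_mul_of_nonneg_right htτ.le hκ) hτ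
    have h1 := (tendsto_pertLimC_rate L M a ha hρ hρ1 hpert ht).2 k
    have h2 := Cpert_mono (d := d) a hκ hC₂ htτ.le hτ
    have hden : 0 < 1 - ρ := sub_pos.mpr hρ1
    refine h1.trans ?_
    rw [hB, div_mul_eq_mul_div]
    exact div_le_div_of_nonneg_right (mul_le_mul_of_nonneg_right h2 (pow_nonneg hρ0 k)) hden.le
  have hgeo : Tendsto (fun k : ℕ => B * ρ ^ k) atTop (𝓝 0) := by
    have := (tendsto_pow_atTop_nhds_zero_of_lt_one hρ0 hρ1).const_mul B
    simpa using this
  rw [Metric.tendstoUniformlyOn_iff]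
  intro ε hε
  have hev : ∀ᶠ k in atTop, B * ρ ^ k < ε := hgeo.eventually (gt_mem_nhds hε)
  filter_upwards [hev] with k hk t htτ
  rw [dist_comm, dist_eq_norm]
  exact lt_of_le_of_lt (hbound t htτ k) hk

/-- **THE LIMIT COVARIANCE IS HOLOMORPHIC IN THE COUPLING, AT RATE `ρ`** (`L⁻¹ ≤ ρ < 1`): `t ↦ c_∞(t)` is complex-differentiable on the
open Neumann disc `{‖t‖κ < 1}` — PART 1's e₂-generic `differentiableAt_pertCovC` at every level plus the locally uniform limit of this §.
[folklore] -/
theorem differentiableOn_pertLimC_rate {ρ : ℝ} (hρ : ((L : ℝ)⁻¹) ≤ ρ) (hρ1 : ρ < 1)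
    {P : (k : ℕ) → Matrix (idx L M k × o) (idx L M k × o) ℂ} {κ C₂ : ℝ}
    (hpert : PerturbationLaws (fun k => calDalev L M a ha k ⊗ₖ (1 : Matrix o o ℂ)) P (fun k => JpcT L M k ⊗ₖ (1 : Matrix o o ℂ)) κ
      (fun k => C₂ * ρ ^ k)) :
    DifferentiableOn ℂ (pertLimC L M a ha P) {t : ℂ | ‖t‖ * κ < 1} := by
  obtain ⟨hκ, -⟩ := consts_nonneg_rate L M a ha hpert
  intro t₀ ht₀
  have ht₀' : ‖t₀‖ * κ < 1 := ht₀
  obtain ⟨τ, hτt, hτ⟩ : ∃ τ : ℝ, ‖t₀‖ < τ ∧ τ * κ < 1 := by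
    rcases eq_or_lt_of_le hκ with h0 | hpos
    · exact ⟨‖t₀‖ + 1, by linarith, by rw [← h0, mul_zero]; exact zero_lt_one⟩
    · have h1 : ‖t₀‖ < κ⁻¹ := by rw [← one_div]; exact (lt_div_iff₀ hpos).mpr ht₀'
      refine ⟨(‖t₀‖ + κ⁻¹) / 2, by linarith, ?_⟩
      have e : (‖t₀‖ + κ⁻¹) / 2 * κ = (‖t₀‖ * κ + 1) / 2 := by field_simp
      rw [e]; linarith
  set V : Set ℂ := {t : ℂ | ‖t‖ < τ} with hV
  have hVopen : IsOpen V := isOpen_lt continuous_norm continuous_const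
  have ht₀V : t₀ ∈ V := hτt
  have hunif := tendstoUniformlyOn_pertCovC_rate L M a ha hρ hρ1 hpert hτ
  have hdiff : ∀ᶠ k in atTop, DifferentiableOn ℂ (fun t => pertCovC L M a ha P t k) V :=
    Eventually.of_forall fun k => fun t htV =>
      (differentiableAt_pertCovC L M a ha hpert k
        (lt_of_le_of_lt (mul_le_mul_of_nonneg_right (le_of_lt htV) hκ) hτ)).differentiableWithinAt
  have hD : DifferentiableOn ℂ (pertLimC L M a ha P) V := hunif.tendstoLocallyUniformlyOn.differentiableOn hdiff hVopen
  exact (hD.differentiableAt (hVopen.mem_nhds ht₀V)).differentiableWithinAt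

/-- **ROOT B ⇐ ONE INSTANCE, ON THE COLOUR LAYER, AT A GENERAL RATE `ρ ∈ [L⁻¹, 1)`**: for every perturbation family `P` with `PerturbationLaws
(Δ_a ⊗ 1) P (J ⊗ 1) κ (C₂·ρ^k)` and every `‖t‖κ < 1`: the NAMED limits `c_∞(t)`, `c_∞(0)` exist, with rate `‖c_k(t) −
c_∞(t)‖ ≤ Cpert(t)·ρ^k/(1 − ρ)`, NE2-LIP `‖c_∞(t) − c_∞(0)‖ ≤ ‖t‖κ·Cst·(1 − ‖t‖κ)⁻¹`, and `c_∞` HOLOMORPHIC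
on the Neumann disc — PART 1's `ne2Plus_resolvent_route_kron` with `L⁻¹ ↦ ρ` (its `hL : 2 ≤ L` only served `L⁻¹ < 1`). [cite: King1986,
Lemma 4.5 (4.32)/(4.38) p.674 (scalar template)] [folklore] -/
theorem ne2Plus_resolvent_route_kron_rate {ρ : ℝ} (hρ : ((L : ℝ)⁻¹) ≤ ρ) (hρ1 : ρ < 1)
    {P : (k : ℕ) → Matrix (idx L M k × o) (idx L M k × o) ℂ} {κ C₂ : ℝ}
    (hpert : PerturbationLaws (fun k => calDalev L M a ha k ⊗ₖ (1 : Matrix o o ℂ)) P (fun k => JpcT L M k ⊗ₖ (1 : Matrix o o ℂ)) κ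
      (fun k => C₂ * ρ ^ k)) {t : ℂ} (ht : ‖t‖ * κ < 1) :
    Tendsto (pertCovC L M a ha P t) atTop (𝓝 (pertLimC L M a ha P t)) ∧
      Tendsto (pertCovC L M a ha P 0) atTop (𝓝 (pertLimC L M a ha P 0)) ∧
      (∀ k, ‖pertCovC L M a ha P t k - pertLimC L M a ha P t‖ ≤ Cpert κ (2 * d * Cst d a) (CJ d a) C₂ 0 t * ρ ^ k / (1 - ρ)) ∧
      ‖pertLimC L M a ha P t - pertLimC L M a ha P 0‖ ≤ ‖t‖ * κ * Cst d a * (1 - ‖t‖ * κ)⁻¹ ∧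
      DifferentiableOn ℂ (pertLimC L M a ha P) {t : ℂ | ‖t‖ * κ < 1} := by
  have h0 : ‖(0 : ℂ)‖ * κ < 1 := by rw [norm_zero, zero_mul]; exact zero_lt_one
  exact ⟨(tendsto_pertLimC_rate L M a ha hρ hρ1 hpert ht).1, (tendsto_pertLimC_rate L M a ha hρ hρ1 hpert h0).1,
    (tendsto_pertLimC_rate L M a ha hρ hρ1 hpert ht).2, pertLimC_sub_pertLimC_zero_le_rate L M a ha hρ hρ1 hpert ht,
    differentiableOn_pertLimC_rate L M a ha hρ hρ1 hpert⟩

/-- **CONSISTENCY WITH THE INSTANCE OF RECORD (kernel)**: at `ρ = L⁻¹` (`L ≥ 2` for `L⁻¹ < 1`) the bundle has EXACTLY the type of PART 1's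
`ne2Plus_resolvent_route_kron`. -/
example (hL : 2 ≤ L) {P : (k : ℕ) → Matrix (idx L M k × o) (idx L M k × o) ℂ} {κ C₂ : ℝ}
    (hpert : PerturbationLaws (fun k => calDalev L M a ha k ⊗ₖ (1 : Matrix o o ℂ)) P (fun k => JpcT L M k ⊗ₖ (1 : Matrix o o ℂ)) κ
      (fun k => C₂ * ((L : ℝ)⁻¹) ^ k)) {t : ℂ} (ht : ‖t‖ * κ < 1) :
    Tendsto (pertCovC L M a ha P t) atTop (𝓝 (pertLimC L M a ha P t)) ∧
      Tendsto (pertCovC L M a ha P 0) atTop (𝓝 (pertLimC L M a ha P 0)) ∧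
      (∀ k, ‖pertCovC L M a ha P t k - pertLimC L M a ha P t‖
          ≤ Cpert κ (2 * d * Cst d a) (CJ d a) C₂ 0 t * ((L : ℝ)⁻¹) ^ k / (1 - (L : ℝ)⁻¹)) ∧
      ‖pertLimC L M a ha P t - pertLimC L M a ha P 0‖ ≤ ‖t‖ * κ * Cst d a * (1 - ‖t‖ * κ)⁻¹ ∧
      DifferentiableOn ℂ (pertLimC L M a ha P) {t : ℂ | ‖t‖ * κ < 1} := by
  have hL1 : (1 : ℝ) < L := by exact_mod_cast (lt_of_lt_of_le one_lt_two hL : 1 < L)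
  exact ne2Plus_resolvent_route_kron_rate L M a ha le_rfl (inv_lt_one_of_one_lt₀ hL1) hpert ht

/-! ## §2 ROOT B's stations on row data at rate `θ` -/

/-- **ROOT B THROUGH EVERY STATION ON ROW DATA AT RATE `θ`** (`d ≥ 1`, `L⁻¹ ≤ θ < 1`): for site-based bond transporters `Rg` in row B5's
(3.35)-shape class whose coefficient towers `{w, Dw}` obey NODE NE3's `LocalRate … C θ` (BY NAME, OPEN), mass `a′ > 0`, the two B4 thresholds,
and every coupling in the Neumann disc `‖t‖·κ_B < 1`: the King-averaged covariances of `(Δ_a^{(k)} ⊗ 1 + t·P_k)⁻¹`, `P = balabanPert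
(liftR Rg) (gaugeSlot …)`, CONVERGE to the NAMED LIMIT (and at `t = 0`), with RATE `Cpert(t)·θ^k/(1 − θ)`, the limit is NE2-LIP and HOLOMORPHIC
on the disc — §1 on PART 4's `perturbationLaws_balaban_final_rate`. `NE2BalabanStations.balaban_final_stations` is the case `θ = L⁻¹`. Model
level (no B0); NE2 NOT proved by this. [cite: Balaban1985BackgroundPropagators, (3.26) p.395 (shape)] [folklore] -/
theorem balaban_final_stations_rate (hd : 1 ≤ d) {Rg : (k : ℕ) → Fin d → (Tor (fine (lev L k) M) → Matrix o o ℂ)}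
    {α β : ℝ} (hreg : RegularTransporters L M (liftR L M Rg) α β) {C θ : ℝ} (hC : 0 ≤ C) (hθ : ((L : ℝ)⁻¹) ≤ θ) (hθ1 : θ < 1)
    (hNE3θ : LocalRate (bgReadings L M (regClass L M (liftR L M Rg))) C θ) {a' : ℝ} (ha' : 0 < a')
    (hκ : kappaS d a' α β (tauR d α) < 1)
    (hsmall : ((sigma0 d a') ^ 2)⁻¹ * deltaK (gS d a' (kappaS d a' α β (tauR d α))) (1 + tauR d α) (d * α) (tauR d α) a' < 1)
    {t : ℂ} (ht : ‖t‖ * kappaBs o d a α β (a * (epsR o d α * (2 + epsR o d α) * Cst d a)) (kappa4F d a a' α β) < 1) :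
    Tendsto (pertCovC L M a ha (balabanPert L M a (liftR L M Rg) (gaugeSlot L M Rg (QuT L M o (siteT L M Rg)) (Q1 L M o) a')) t) atTop
        (𝓝 (pertLimC L M a ha (balabanPert L M a (liftR L M Rg) (gaugeSlot L M Rg (QuT L M o (siteT L M Rg)) (Q1 L M o) a')) t)) ∧
      Tendsto (pertCovC L M a ha (balabanPert L M a (liftR L M Rg) (gaugeSlot L M Rg (QuT L M o (siteT L M Rg)) (Q1 L M o) a')) 0) atTop
        (𝓝 (pertLimC L M a ha (balabanPert L M a (liftR L M Rg) (gaugeSlot L M Rg (QuT L M o (siteT L M Rg)) (Q1 L M o) a')) 0)) ∧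
      (∀ k, ‖pertCovC L M a ha (balabanPert L M a (liftR L M Rg) (gaugeSlot L M Rg (QuT L M o (siteT L M Rg)) (Q1 L M o) a')) t k
            - pertLimC L M a ha (balabanPert L M a (liftR L M Rg) (gaugeSlot L M Rg (QuT L M o (siteT L M Rg)) (Q1 L M o) a')) t‖
          ≤ Cpert (kappaBs o d a α β (a * (epsR o d α * (2 + epsR o d α) * Cst d a)) (kappa4F d a a' α β)) (2 * d * Cst d a) (CJ d a)
              (C2Bs o d L a α β C
                (a * C2gram (Cst d a) 1 (epsR o d α) (2 * d * Cst d a) (CJ d a) (Cst d a) (CdeltaR o d a α (theta0 d α (betaNE3 o C))))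
                (C4F o d L a a' α β C)) 0 t * θ ^ k / (1 - θ)) ∧
      ‖pertLimC L M a ha (balabanPert L M a (liftR L M Rg) (gaugeSlot L M Rg (QuT L M o (siteT L M Rg)) (Q1 L M o) a')) t
          - pertLimC L M a ha (balabanPert L M a (liftR L M Rg) (gaugeSlot L M Rg (QuT L M o (siteT L M Rg)) (Q1 L M o) a')) 0‖
        ≤ ‖t‖ * kappaBs o d a α β (a * (epsR o d α * (2 + epsR o d α) * Cst d a)) (kappa4F d a a' α β) * Cst d a
          * (1 - ‖t‖ * kappaBs o d a α β (a * (epsR o d α * (2 + epsR o d α) * Cst d a)) (kappa4F d a a' α β))⁻¹ ∧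
      DifferentiableOn ℂ (pertLimC L M a ha (balabanPert L M a (liftR L M Rg) (gaugeSlot L M Rg (QuT L M o (siteT L M Rg)) (Q1 L M o) a')))
        {t : ℂ | ‖t‖ * kappaBs o d a α β (a * (epsR o d α * (2 + epsR o d α) * Cst d a)) (kappa4F d a a' α β) < 1} := by
  have h := perturbationLaws_balaban_final_rate L M a ha hd hreg hC hθ hθ1.le hNE3θ ha' hκ hsmall
  rw [kappaQ_ofReal ha.le] at h
  exact ne2Plus_resolvent_route_kron_rate L M a ha hθ hθ1 h ht

/-- **ROW B8 — THE STATIONS UNDER THE ONE EXPLICIT THRESHOLD, FOR EVERY `‖t‖ ≤ 1`, AT RATE `θ`** (`d ≥ 1`, `L⁻¹ ≤ θ < 1`, `a′ >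
0`): displayed binders ONLY `hreg`, `hNE3θ` (node NE3 BY NAME at rate `θ`, OPEN), `0 < a′`, `α ≤ η`, `β ≤ η`, `η ≤ etaStar o d a a′`,
`‖t‖ ≤ 1` ⟹ named limit, limit at `t = 0`, rate `θ^k`, NE2-LIP and holomorphy on the Neumann disc for Bałaban's typed tier-B operator —
the B4 thresholds from `smallness_of_le` and the disc membership from `NE2BalabanStations.norm_mul_kappaBs_lt_one_of_regular` (both θ-free).
`NE2BalabanStations.balaban_final_stations_of_regular` is the case `θ = L⁻¹`. Model level (no B0); NE2 (U1a) NOT proved by this. [folklore] -/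
theorem balaban_final_stations_of_regular_rate (hd : 1 ≤ d) {Rg : (k : ℕ) → Fin d → (Tor (fine (lev L k) M) → Matrix o o ℂ)}
    {α β : ℝ} (hreg : RegularTransporters L M (liftR L M Rg) α β) {C θ : ℝ} (hC : 0 ≤ C) (hθ : ((L : ℝ)⁻¹) ≤ θ) (hθ1 : θ < 1)
    (hNE3θ : LocalRate (bgReadings L M (regClass L M (liftR L M Rg))) C θ) {a' : ℝ} (ha' : 0 < a')
    {η : ℝ} (hαη : α ≤ η) (hβη : β ≤ η) (hη : η ≤ etaStar o d a a') {t : ℂ} (ht : ‖t‖ ≤ 1) :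
    Tendsto (pertCovC L M a ha (balabanPert L M a (liftR L M Rg) (gaugeSlot L M Rg (QuT L M o (siteT L M Rg)) (Q1 L M o) a')) t) atTop
        (𝓝 (pertLimC L M a ha (balabanPert L M a (liftR L M Rg) (gaugeSlot L M Rg (QuT L M o (siteT L M Rg)) (Q1 L M o) a')) t)) ∧
      Tendsto (pertCovC L M a ha (balabanPert L M a (liftR L M Rg) (gaugeSlot L M Rg (QuT L M o (siteT L M Rg)) (Q1 L M o) a')) 0) atTop
        (𝓝 (pertLimC L M a ha (balabanPert L M a (liftR L M Rg) (gaugeSlot L M Rg (QuT L M o (siteT L M Rg)) (Q1 L M o) a')) 0)) ∧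
      (∀ k, ‖pertCovC L M a ha (balabanPert L M a (liftR L M Rg) (gaugeSlot L M Rg (QuT L M o (siteT L M Rg)) (Q1 L M o) a')) t k
            - pertLimC L M a ha (balabanPert L M a (liftR L M Rg) (gaugeSlot L M Rg (QuT L M o (siteT L M Rg)) (Q1 L M o) a')) t‖
          ≤ Cpert (kappaBs o d a α β (a * (epsR o d α * (2 + epsR o d α) * Cst d a)) (kappa4F d a a' α β)) (2 * d * Cst d a) (CJ d a)
              (C2Bs o d L a α β C
                (a * C2gram (Cst d a) 1 (epsR o d α) (2 * d * Cst d a) (CJ d a) (Cst d a) (CdeltaR o d a α (theta0 d α (betaNE3 o C))))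
                (C4F o d L a a' α β C)) 0 t * θ ^ k / (1 - θ)) ∧
      ‖pertLimC L M a ha (balabanPert L M a (liftR L M Rg) (gaugeSlot L M Rg (QuT L M o (siteT L M Rg)) (Q1 L M o) a')) t
          - pertLimC L M a ha (balabanPert L M a (liftR L M Rg) (gaugeSlot L M Rg (QuT L M o (siteT L M Rg)) (Q1 L M o) a')) 0‖
        ≤ ‖t‖ * kappaBs o d a α β (a * (epsR o d α * (2 + epsR o d α) * Cst d a)) (kappa4F d a a' α β) * Cst d a
          * (1 - ‖t‖ * kappaBs o d a α β (a * (epsR o d α * (2 + epsR o d α) * Cst d a)) (kappa4F d a a' α β))⁻¹ ∧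
      DifferentiableOn ℂ (pertLimC L M a ha (balabanPert L M a (liftR L M Rg) (gaugeSlot L M Rg (QuT L M o (siteT L M Rg)) (Q1 L M o) a')))
        {t : ℂ | ‖t‖ * kappaBs o d a α β (a * (epsR o d α * (2 + epsR o d α) * Cst d a)) (kappa4F d a a' α β) < 1} := by
  obtain ⟨h1, h2, -, -, -, -, -, -⟩ := smallness_of_le (o := o) (d := d) a ha.le ha' hreg.nonneg.1 hreg.nonneg.2 hαη hβη hη
  exact balaban_final_stations_rate L M a ha hd hreg hC hθ hθ1 hNE3θ ha' h1 h2
    (norm_mul_kappaBs_lt_one_of_regular (o := o) (d := d) a ha.le ha' hreg.nonneg.1 hreg.nonneg.2 hαη hβη hη ht)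

/-- **HOLOMORPHY OF THE LIMIT ON THE CLOSED UNIT DISC AT RATE `θ`** under `α, β ≤ η ≤ η⋆`: `t ↦ pertLimC P t` is complex-differentiable on a
neighbourhood of every `‖t‖ ≤ 1` — the physical coupling `t = 1` is interior.  Model level; NE2 NOT proved by this. [folklore] -/
theorem differentiableOn_balaban_final_unitBall_rate (hd : 1 ≤ d) {Rg : (k : ℕ) → Fin d → (Tor (fine (lev L k) M) → Matrix o o ℂ)}
    {α β : ℝ} (hreg : RegularTransporters L M (liftR L M Rg) α β) {C θ : ℝ} (hC : 0 ≤ C) (hθ : ((L : ℝ)⁻¹) ≤ θ) (hθ1 : θ < 1)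
    (hNE3θ : LocalRate (bgReadings L M (regClass L M (liftR L M Rg))) C θ) {a' : ℝ} (ha' : 0 < a')
    {η : ℝ} (hαη : α ≤ η) (hβη : β ≤ η) (hη : η ≤ etaStar o d a a') :
    DifferentiableOn ℂ (pertLimC L M a ha (balabanPert L M a (liftR L M Rg) (gaugeSlot L M Rg (QuT L M o (siteT L M Rg)) (Q1 L M o) a')))
      {t : ℂ | ‖t‖ ≤ 1} := by
  have h1 : ‖(1 : ℂ)‖ ≤ 1 := by rw [norm_one]
  obtain ⟨-, -, -, -, hD⟩ := balaban_final_stations_of_regular_rate L M a ha hd hreg hC hθ hθ1 hNE3θ ha' hαη hβη hη h1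
  exact hD.mono fun t ht => norm_mul_kappaBs_lt_one_of_regular (o := o) (d := d) a ha.le ha' hreg.nonneg.1 hreg.nonneg.2 hαη hβη hη ht

/-- **CONSISTENCY WITH THE INSTANCE OF RECORD (kernel)**: at `θ = L⁻¹` the row-data stations have EXACTLY the type of
`NE2BalabanStations.balaban_final_stations_of_regular` (`L ≥ 2` for `L⁻¹ < 1`). -/
example (hL : 2 ≤ L) (hd : 1 ≤ d) {Rg : (k : ℕ) → Fin d → (Tor (fine (lev L k) M) → Matrix o o ℂ)}
    {α β : ℝ} (hreg : RegularTransporters L M (liftR L M Rg) α β) {C : ℝ} (hC : 0 ≤ C)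
    (hNE3 : LocalRate (bgReadings L M (regClass L M (liftR L M Rg))) C ((L : ℝ)⁻¹)) {a' : ℝ} (ha' : 0 < a')
    {η : ℝ} (hαη : α ≤ η) (hβη : β ≤ η) (hη : η ≤ etaStar o d a a') {t : ℂ} (ht : ‖t‖ ≤ 1) :
    Tendsto (pertCovC L M a ha (balabanPert L M a (liftR L M Rg) (gaugeSlot L M Rg (QuT L M o (siteT L M Rg)) (Q1 L M o) a')) t) atTop
        (𝓝 (pertLimC L M a ha (balabanPert L M a (liftR L M Rg) (gaugeSlot L M Rg (QuT L M o (siteT L M Rg)) (Q1 L M o) a')) t)) ∧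
      Tendsto (pertCovC L M a ha (balabanPert L M a (liftR L M Rg) (gaugeSlot L M Rg (QuT L M o (siteT L M Rg)) (Q1 L M o) a')) 0) atTop
        (𝓝 (pertLimC L M a ha (balabanPert L M a (liftR L M Rg) (gaugeSlot L M Rg (QuT L M o (siteT L M Rg)) (Q1 L M o) a')) 0)) ∧
      (∀ k, ‖pertCovC L M a ha (balabanPert L M a (liftR L M Rg) (gaugeSlot L M Rg (QuT L M o (siteT L M Rg)) (Q1 L M o) a')) t k
            - pertLimC L M a ha (balabanPert L M a (liftR L M Rg) (gaugeSlot L M Rg (QuT L M o (siteT L M Rg)) (Q1 L M o) a')) t‖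
          ≤ Cpert (kappaBs o d a α β (a * (epsR o d α * (2 + epsR o d α) * Cst d a)) (kappa4F d a a' α β)) (2 * d * Cst d a) (CJ d a)
              (C2Bs o d L a α β C
                (a * C2gram (Cst d a) 1 (epsR o d α) (2 * d * Cst d a) (CJ d a) (Cst d a) (CdeltaR o d a α (theta0 d α (betaNE3 o C))))
                (C4F o d L a a' α β C)) 0 t * ((L : ℝ)⁻¹) ^ k / (1 - (L : ℝ)⁻¹)) ∧
      ‖pertLimC L M a ha (balabanPert L M a (liftR L M Rg) (gaugeSlot L M Rg (QuT L M o (siteT L M Rg)) (Q1 L M o) a')) t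
          - pertLimC L M a ha (balabanPert L M a (liftR L M Rg) (gaugeSlot L M Rg (QuT L M o (siteT L M Rg)) (Q1 L M o) a')) 0‖
        ≤ ‖t‖ * kappaBs o d a α β (a * (epsR o d α * (2 + epsR o d α) * Cst d a)) (kappa4F d a a' α β) * Cst d a
          * (1 - ‖t‖ * kappaBs o d a α β (a * (epsR o d α * (2 + epsR o d α) * Cst d a)) (kappa4F d a a' α β))⁻¹ ∧
      DifferentiableOn ℂ (pertLimC L M a ha (balabanPert L M a (liftR L M Rg) (gaugeSlot L M Rg (QuT L M o (siteT L M Rg)) (Q1 L M o) a')))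
        {t : ℂ | ‖t‖ * kappaBs o d a α β (a * (epsR o d α * (2 + epsR o d α) * Cst d a)) (kappa4F d a a' α β) < 1} := by
  have hL1 : (1 : ℝ) < L := by exact_mod_cast (lt_of_lt_of_le one_lt_two hL : 1 < L)
  exact balaban_final_stations_of_regular_rate L M a ha hd hreg hC le_rfl (inv_lt_one_of_one_lt₀ hL1) hNE3 ha' hαη hβη hη ht

end Summit.QuantumFields.BalabanUV.T4Continuum.NE2BalabanStationsRate

end
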